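import Literature.Geometry.Lorentzian.BogovskiiVectorOperator
import Literature.Geometry.Lorentzian.MomentPartitionVec
import Literature.Geometry.Lorentzian.AnnulusStarCover
import Mathlib.Topology.PartitionOfUnity
import Mathlib.Analysis.Calculus.BumpFunction.FiniteDimension
import Mathlib.Analysis.Calculus.BumpFunction.Normed
import HarnessLib

/-!
# Gluing Bogovskiĭ-type operators for the symmetric divergence (Lemma 2.2, `T`-part), weak form; the annulus

(trunk G08 = T-LORENTZ; family `gr`; namespace `Literature.Geometry.Lorentzian.MaoOhTao`.)

Mao–Oh–Tao (arXiv:2308.13031), Lemma 2.2 (p. 8), second part: on the annulus `A₁` there is an operator `T` on vector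
densities `f` with `∫ f·(e₁, e₂, e₃, Y₁, Y₂, Y₃)† = 0` such that (T1) `supp f ⊆ A₁ ⟹ supp T f ⊆ A₁` and (T2)
`∂_i (T f)^{ij} = f^j`; proof (p. 9): "The case of `T` is similar" — Lemma 2.3 on sets star-shaped with respect to a
ball, the splitting of `MomentPartitionVec.lean`, and a recursion over a finite cover of `A₁`.  This file is the
`T`-analogue of `BogovskiiGluing.lean` + `BogovskiiAnnulus.lean`, in weak, per-density form:

* `symmDivPairing SV SK ψ` — the weak symmetric-divergence pairing `Σ_{i,j} ⟨(T F)^{ij}, ∂ᵢψⱼ⟩` of the divergence-form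
  fields `SV^a_k, SK^{ab}_k` of `BogovskiiVectorOperator.lean` (linear: `symmDivPairing_add`);
* `HasWeakSymmDivInverse U` — every `F ∈ C_c(ℝ³; ℝ³)` with `tsupp F ⊆ U` and vanishing Killing moments admits fields
  `SV, SK` supported in `U` with `symmDivPairing SV SK ψ = −Σ_j ∫ F^j ψ_j` for all `ψ ∈ C²_c` (`∂_i (T F)^{ij} = F^j` in
  `𝒟'` for `(T F)^{ij} = ½(SV^i_j + SV^j_i) + ½∂_m(SK^{im}_j + SK^{jm}_i) − ∂_k SK^{ij}_k`);
* `killing_moments_translation`, `killing_moments_rotation` — the Killing moment conditions in the form used by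
  `BogovskiiVectorOperator.lean`;
* `HasWeakSymmDivInverse.of_starConvex` (Lemma 2.3), `.union` (gluing), `.biUnion_le` (recursion),
  `hasWeakSymmDivInverse_annulus` — **Lemma 2.2 (T1)–(T2) in weak form on `A₁`**.

Everything is proved; two definitions (`symmDivPairing`, `HasWeakSymmDivInverse`), no named facts.
`TODO(general form)`: linearity of `T` in `F` (fixed cut-offs) and the bounds (T3), (T4).

## References

* Y. Mao, S.-J. Oh, T. Tao, arXiv:2308.13031 (2023), Lemma 2.2 and its proof, pp. 8–9 (key `MaoOhTao2023`).
-/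

noncomputable section

open scoped RealInnerProductSpace Topology ContDiff
open Filter MeasureTheory Set Metric Function

namespace Literature.Geometry.Lorentzian

namespace MaoOhTao

/-! ### The weak symmetric-divergence pairing -/

/-- **The weak symmetric-divergence pairing** of divergence-form fields `(SV, SK)` with a test field `ψ`:
`Σ_{j,k} [δ_{jk}(½ Σ_i ∫ SV^i_k ∂ᵢψⱼ − ½ Σ_{i,m} ∫ SK^{im}_k ∂ₘ∂ᵢψⱼ) + ½ ∫ SV^j_k ∂ₖψⱼ − ½ Σ_m ∫ SK^{jm}_k ∂ₘ∂ₖψⱼ`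
`+ Σ_i ∫ SK^{ij}_k ∂ᵢ∂ₖψⱼ]` `= Σ_{i,j} ⟨(T F)^{ij}, ∂ᵢψⱼ⟩` for
`(T F)^{ij} = ½(SV^i_j + SV^j_i) + ½∂_m(SK^{im}_j + SK^{jm}_i) − ∂_k SK^{ij}_k`. [cite: MaoOhTao2023, Lemma 2.3 (T2)] -/
def symmDivPairing (SV : Fin 3 → Fin 3 → E3 → ℝ) (SK : Fin 3 → Fin 3 → Fin 3 → E3 → ℝ) (ψ : Fin 3 → E3 → ℝ) : ℝ :=
  ∑ j, ∑ k, ((if j = k then (1 : ℝ) else 0) *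
      ((1 / 2 : ℝ) * (∑ i, ∫ x : E3, SV i k x * pd i (ψ j) x) -
        (1 / 2 : ℝ) * ∑ i, ∑ m, ∫ x : E3, SK i m k x * pd m (pd i (ψ j)) x) +
    (1 / 2 : ℝ) * (∫ x : E3, SV j k x * pd k (ψ j) x) -
    (1 / 2 : ℝ) * (∑ m, ∫ x : E3, SK j m k x * pd m (pd k (ψ j)) x) +
    ∑ i, ∫ x : E3, SK i j k x * pd i (pd k (ψ j)) x)

/-- **Linearity of the pairing** in the fields (given integrability of all entries). [folklore] -/
theorem symmDivPairing_add {SV₁ SV₂ : Fin 3 → Fin 3 → E3 → ℝ} {SK₁ SK₂ : Fin 3 → Fin 3 → Fin 3 → E3 → ℝ}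
    {ψ : Fin 3 → E3 → ℝ} (hV₁ : ∀ a k j i, Integrable fun x : E3 ↦ SV₁ a k x * pd i (ψ j) x)
    (hV₂ : ∀ a k j i, Integrable fun x : E3 ↦ SV₂ a k x * pd i (ψ j) x)
    (hK₁ : ∀ a b k j i m, Integrable fun x : E3 ↦ SK₁ a b k x * pd m (pd i (ψ j)) x)
    (hK₂ : ∀ a b k j i m, Integrable fun x : E3 ↦ SK₂ a b k x * pd m (pd i (ψ j)) x) :
    symmDivPairing (fun a k x ↦ SV₁ a k x + SV₂ a k x) (fun a b k x ↦ SK₁ a b k x + SK₂ a b k x) ψ =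
      symmDivPairing SV₁ SK₁ ψ + symmDivPairing SV₂ SK₂ ψ := by
  have hsV : ∀ a k j i, ∫ x : E3, (SV₁ a k x + SV₂ a k x) * pd i (ψ j) x =
      (∫ x : E3, SV₁ a k x * pd i (ψ j) x) + ∫ x : E3, SV₂ a k x * pd i (ψ j) x := by
    intro a k j i
    rw [← integral_add (hV₁ a k j i) (hV₂ a k j i)]
    exact integral_congr_ae (ae_of_all _ fun x ↦ by simp only; ring)
  have hsK : ∀ a b k j i m, ∫ x : E3, (SK₁ a b k x + SK₂ a b k x) * pd m (pd i (ψ j)) x =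
      (∫ x : E3, SK₁ a b k x * pd m (pd i (ψ j)) x) + ∫ x : E3, SK₂ a b k x * pd m (pd i (ψ j)) x := by
    intro a b k j i m
    rw [← integral_add (hK₁ a b k j i m) (hK₂ a b k j i m)]
    exact integral_congr_ae (ae_of_all _ fun x ↦ by simp only; ring)
  simp only [symmDivPairing]
  rw [← Finset.sum_add_distrib]
  refine Finset.sum_congr rfl fun j _ ↦ ?_
  rw [← Finset.sum_add_distrib]
  refine Finset.sum_congr rfl fun k _ ↦ ?_
  simp only [hsV, hsK, Finset.sum_add_distrib]
  ring

/-! ### Weak solvability of the symmetric divergence equation -/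

/-- **Weak solvability of the symmetric divergence equation on `U`** ((T1)–(T2) per density): every
`F ∈ C_c(ℝ³; ℝ³)` with `tsupp F^k ⊆ U` and vanishing Killing moments `∫ F·K_a = 0` admits divergence-form fields
`SV, SK` supported in `U`, with integrable pairings, such that `symmDivPairing SV SK ψ = −Σ_j ∫ F^j ψ_j` for all
`ψ ∈ C²_c(ℝ³; ℝ³)`. [cite: MaoOhTao2023, Lemma 2.2 (T1)–(T2)] -/
def HasWeakSymmDivInverse (U : Set E3) : Prop :=
  ∀ F : Fin 3 → E3 → ℝ, (∀ k, Continuous (F k)) → (∀ k, HasCompactSupport (F k)) →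
    (∀ k, tsupport (F k) ⊆ U) → (∀ a, ∫ y : E3, ∑ j, F j y * killingFn a y j = 0) →
      ∃ (SV : Fin 3 → Fin 3 → E3 → ℝ) (SK : Fin 3 → Fin 3 → Fin 3 → E3 → ℝ),
        (∀ a k, support (SV a k) ⊆ U) ∧ (∀ a b k, support (SK a b k) ⊆ U) ∧
          ∀ ψ : Fin 3 → E3 → ℝ, (∀ j, ContDiff ℝ 2 (ψ j)) → (∀ j, HasCompactSupport (ψ j)) →
            (∀ a k j i, Integrable fun x : E3 ↦ SV a k x * pd i (ψ j) x) ∧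
              (∀ a b k j i m, Integrable fun x : E3 ↦ SK a b k x * pd m (pd i (ψ j)) x) ∧
                symmDivPairing SV SK ψ = -∑ j, ∫ y : E3, F j y * ψ j y

/-! ### The Killing moment conditions -/

section Moments

variable {F : Fin 3 → E3 → ℝ}

/-- Translation moments: `∫ F·e_k = ∫ F^k`. [folklore] -/
theorem killing_moments_translation (hK : ∀ a, ∫ y : E3, ∑ j, F j y * killingFn a y j = 0) (k : Fin 3) :
    ∫ y : E3, F k y = 0 := by
  have h := hK (Sum.inl k)
  simp only [killingFn_inl, e, PiLp.single_apply, mul_ite, mul_one, mul_zero, Finset.sum_ite_eq',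
    Finset.mem_univ, if_true] at h
  exact h

/-- Rotation moments: `∫ F·Y_l = 0` for all `l` gives the symmetry `∫ y_m F^j = ∫ y_j F^m`. [folklore] -/
theorem killing_moments_rotation (hF : ∀ k, Continuous (F k)) (hFc : ∀ k, HasCompactSupport (F k))
    (hK : ∀ a, ∫ y : E3, ∑ j, F j y * killingFn a y j = 0) (m j : Fin 3) :
    ∫ y : E3, y m * F j y = ∫ y : E3, y j * F m y := by
  have I : ∀ m j, Integrable fun y : E3 ↦ y m * F j y := fun m j ↦
    ((EuclideanSpace.proj (𝕜 := ℝ) m).continuous.mul (hF j)).integrable_of_hasCompactSupport (hFc j).mul_left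
  have hrot : ∀ l, ∫ y : E3, ∑ j, F j y * rotGen l y j = 0 := fun l ↦ by simpa using hK (Sum.inr l)
  -- the three rotations give the three off-diagonal symmetries
  have h0 := hrot 0
  have h1 := hrot 1
  have h2 := hrot 2
  simp only [rotGen, e, PiLp.single_apply, Fin.sum_univ_three, Fin.isValue, Matrix.cons_val_zero,
    Matrix.cons_val_one, Matrix.cons_val] at h0 h1 h2
  norm_num [Fin.ext_iff] at h0 h1 h2
  -- `h0 : ∫ (-(F 1 y * y 2) + F 2 y * y 1) = 0`, etc.
  have e12 : ∫ y : E3, y 1 * F 2 y = ∫ y : E3, y 2 * F 1 y := by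
    have : ∫ y : E3, (y 1 * F 2 y - y 2 * F 1 y) = 0 := by
      rw [← h0]; exact integral_congr_ae (ae_of_all _ fun y ↦ by ring)
    rw [integral_sub (I 1 2) (I 2 1)] at this
    linarith
  have e20 : ∫ y : E3, y 2 * F 0 y = ∫ y : E3, y 0 * F 2 y := by
    have : ∫ y : E3, (y 2 * F 0 y - y 0 * F 2 y) = 0 := by
      rw [← h1]; exact integral_congr_ae (ae_of_all _ fun y ↦ by ring)
    rw [integral_sub (I 2 0) (I 0 2)] at this
    linarith
  have e01 : ∫ y : E3, y 0 * F 1 y = ∫ y : E3, y 1 * F 0 y := by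
    have : ∫ y : E3, (y 0 * F 1 y - y 1 * F 0 y) = 0 := by
      rw [← h2]; exact integral_congr_ae (ae_of_all _ fun y ↦ by ring)
    rw [integral_sub (I 0 1) (I 1 0)] at this
    linarith
  fin_cases m <;> fin_cases j
  · rfl
  · exact e01
  · exact e20.symm
  · exact e01.symm
  · rfl
  · exact e12
  · exact e20
  · exact e12.symm
  · rfl

end Moments

/-! ### Base case, gluing, recursion -/

section Recursion

/-- **Base case: star-shaped sets** (Lemma 2.3, `T`-part). If `Ω` is star-shaped with respect to every point of an
open ball, then `Ω` has weak solvability of the symmetric divergence equation: take the fields `SV, SK` of the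
Bogovskiĭ-type vector operator with the normalised bump of that ball (`BogovskiiVectorOperator.lean`).
[cite: MaoOhTao2023, Lemma 2.3 (T1)–(T2)] -/
theorem HasWeakSymmDivInverse.of_starConvex {Ω : Set E3} {c : E3} {r : ℝ} (hr : 0 < r)
    (hΩ : ∀ b ∈ ball c r, StarConvex ℝ b Ω) : HasWeakSymmDivInverse Ω := by
  intro F hF hFc hFΩ hK
  -- the normalised bump `ζ` supported in `ball c r`
  let b : ContDiffBump c := ⟨r / 4, r / 2, by positivity, by linarith⟩
  set ζ : E3 → ℝ := b.normed volume with hζdef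
  have hζ : ContDiff ℝ 1 ζ := b.contDiff_normed
  have hζ1 : ∫ z : E3, ζ z = 1 := b.integral_normed
  have hζB : ∀ z, ζ z ≠ 0 → z ∈ ball c r := fun z hz ↦ by
    have : z ∈ support ζ := mem_support.2 hz
    rw [hζdef, b.support_normed_eq] at this
    exact ball_subset_ball (by show r / 2 ≤ r; linarith) this
  have hR : ∀ z : E3, ‖c‖ + r < ‖z‖ → ζ z = 0 := by
    intro z hz
    by_contra h
    have hzB := hζB z h
    rw [mem_ball, dist_eq_norm] at hzB
    have : ‖z‖ ≤ ‖z - c‖ + ‖c‖ := norm_le_norm_sub_add z c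
    linarith
  have hFΩ' : ∀ k y, F k y ≠ 0 → y ∈ Ω := fun k y hy ↦ hFΩ k (subset_tsupport _ (mem_support.2 hy))
  have hF0 := killing_moments_translation hK
  have hFA := killing_moments_rotation hF hFc hK
  refine ⟨fun a k x ↦ ∫ y : E3, bogovskiiWeight ζ y ‖x - y‖ (‖x - y‖⁻¹ • (x - y)) *
      ((x - y) a * (‖x - y‖ ^ 3)⁻¹) * F k y,
    fun a b' k x ↦ ∫ y : E3, bogovskiiWeight ζ y ‖x - y‖ (‖x - y‖⁻¹ • (x - y)) *
      ((x - y) a * ((x - y) b' * (‖x - y‖ ^ 3)⁻¹)) * F k y,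
    fun a k ↦ support_bogovskiiV_operator_subset hΩ hζB (hFΩ' k) a,
    fun a b' k ↦ support_bogovskiiOperator_subset hΩ hζB (hFΩ' k) a b', fun ψ hψ hψc ↦ ?_⟩
  have hg1 : ∀ j i, Continuous (pd i (ψ j)) := fun j i ↦
    ((hψ j).continuous_fderiv two_ne_zero).clm_apply continuous_const
  have hg1c : ∀ j i, HasCompactSupport (pd i (ψ j)) := fun j i ↦ hasCompactSupport_pd (hψc j) i
  have hg2 : ∀ j i m, Continuous (pd m (pd i (ψ j))) := fun j i m ↦
    ((contDiff_pd (n := 1) (hψ j) i).continuous_fderiv one_ne_zero).clm_apply continuous_const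
  have hg2c : ∀ j i m, HasCompactSupport (pd m (pd i (ψ j))) := fun j i m ↦
    hasCompactSupport_pd (hasCompactSupport_pd (hψc j) i) m
  refine ⟨fun a k j i ↦ ?_, fun a b' k j i m ↦ ?_, ?_⟩
  · refine ((integrable_bogovskiiV_prod hζ.continuous hR (hF k) (hFc k) (hg1 j i) (hg1c j i) a)
      |>.integral_prod_left).congr (ae_of_all _ fun x ↦ ?_)
    simp only
    rw [integral_mul_const]
  · refine ((integrable_bogovskiiKernel_prod hζ.continuous hR (hF k) (hFc k) (hg2 j i m) (hg2c j i m) a b')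
      |>.integral_prod_left).congr (ae_of_all _ fun x ↦ ?_)
    simp only
    rw [integral_mul_const]
  · have h := sum_sum_bogovskiiVectorOperator_weak_eq hζ hR hF hFc hF0 hFA hψ hψc
    rw [hζ1, one_mul] at h
    exact h

/-- **Gluing**: weak solvability of the symmetric divergence equation passes to the union of two open sets with a
common point (bump at the common point, partition of unity on `⋃_k tsupp F^k`, the splitting `F = F₁ + F₂` of
`MomentPartitionVec.lean`, and `SV = SV₁ + SV₂`, `SK = SK₁ + SK₂`). [cite: MaoOhTao2023, Lemma 2.2 (proof)] -/
theorem HasWeakSymmDivInverse.union {U₁ U₂ : Set E3} (hU₁ : IsOpen U₁) (hU₂ : IsOpen U₂) {p : E3}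
    (hp₁ : p ∈ U₁) (hp₂ : p ∈ U₂) (h₁ : HasWeakSymmDivInverse U₁) (h₂ : HasWeakSymmDivInverse U₂) :
    HasWeakSymmDivInverse (U₁ ∪ U₂) := by
  intro F hF hFc hFU hK
  -- a bump at `p` supported in `U₁ ∩ U₂`
  obtain ⟨ε, hε, hball⟩ := Metric.isOpen_iff.1 (hU₁.inter hU₂) p ⟨hp₁, hp₂⟩
  let b : ContDiffBump p := ⟨ε / 4, ε / 2, by positivity, by linarith⟩
  set η : E3 → ℝ := fun x ↦ b x with hηdef
  have hη : Continuous η := b.continuous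
  have hηc : HasCompactSupport η := b.hasCompactSupport
  have hηp : η p ≠ 0 := by
    have : η p = 1 := b.one_of_mem_closedBall (mem_closedBall_self (by positivity))
    rw [this]; exact one_ne_zero
  have hηU : tsupport η ⊆ U₁ ∩ U₂ := by
    rw [hηdef, b.tsupport_eq]
    exact (closedBall_subset_ball (by show ε / 2 < ε; linarith)).trans hball
  -- a partition of unity on `⋃_k tsupp F^k` subordinate to `{U₁, U₂}`
  let V : Bool → Set E3 := fun c ↦ cond c U₁ U₂
  have hVo : ∀ c, IsOpen (V c) := fun c ↦ by cases c <;> assumption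
  set K : Set E3 := ⋃ k, tsupport (F k) with hKdef
  have hKc : IsClosed K := isClosed_iUnion_of_finite fun k ↦ isClosed_tsupport (F k)
  have hKV : K ⊆ ⋃ c, V c := by
    intro x hx
    obtain ⟨k, hk⟩ := mem_iUnion.1 hx
    rcases hFU k hk with h | h
    · exact mem_iUnion.2 ⟨true, h⟩
    · exact mem_iUnion.2 ⟨false, h⟩
  obtain ⟨ρ, hρ⟩ := PartitionOfUnity.exists_isSubordinate hKc V hVo hKV
  set χ₁ : E3 → ℝ := fun x ↦ ρ true x with hχ₁def
  set χ₂ : E3 → ℝ := fun x ↦ ρ false x with hχ₂def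
  have hχ₁ : Continuous χ₁ := (ρ true).continuous
  have hχ₂ : Continuous χ₂ := (ρ false).continuous
  have hχ₁U : tsupport χ₁ ⊆ U₁ := hρ true
  have hχ₂U : tsupport χ₂ ⊆ U₂ := hρ false
  have hsum : ∀ x, (∃ j, F j x ≠ 0) → χ₁ x + χ₂ x = 1 := by
    rintro x ⟨j, hx⟩
    have hxK : x ∈ K := mem_iUnion.2 ⟨j, subset_tsupport _ (mem_support.2 hx)⟩
    have h := ρ.sum_eq_one hxK
    rw [finsum_eq_sum_of_fintype, Fintype.sum_bool] at h
    exact h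
  -- split `F = F₁ + F₂` and invert the pieces
  have hadm : ∀ (χ : E3 → ℝ), Continuous χ → ∀ {U : Set E3}, tsupport χ ⊆ U → tsupport η ⊆ U →
      (∀ k, Continuous (momentPartK η F χ k)) ∧ (∀ k, HasCompactSupport (momentPartK η F χ k)) ∧
        (∀ k, tsupport (momentPartK η F χ k) ⊆ U) ∧
          ∀ a, ∫ y : E3, ∑ j, momentPartK η F χ j y * killingFn a y j = 0 := by
    intro χ hχ U hχU hηU'
    exact ⟨fun k ↦ continuous_momentPartK hη hF hχ k, fun k ↦ hasCompactSupport_momentPartK hηc hFc χ k,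
      fun k ↦ tsupport_momentPartK_subset ((tsupport_mul_subset_right (f := F k) (g := χ)).trans hχU) hηU',
      fun a ↦ integral_momentPartK_killingFn hη hηc hηp hF hFc hχ a⟩
  obtain ⟨c₁, s₁, t₁, m₁⟩ := hadm χ₁ hχ₁ hχ₁U (hηU.trans inter_subset_left)
  obtain ⟨c₂, s₂, t₂, m₂⟩ := hadm χ₂ hχ₂ hχ₂U (hηU.trans inter_subset_right)
  obtain ⟨SV₁, SK₁, hV₁s, hK₁s, hP₁⟩ := h₁ _ c₁ s₁ t₁ m₁
  obtain ⟨SV₂, SK₂, hV₂s, hK₂s, hP₂⟩ := h₂ _ c₂ s₂ t₂ m₂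
  refine ⟨fun a k x ↦ SV₁ a k x + SV₂ a k x, fun a b' k x ↦ SK₁ a b' k x + SK₂ a b' k x,
    fun a k ↦ (support_add (SV₁ a k) (SV₂ a k)).trans (union_subset_union (hV₁s a k) (hV₂s a k)),
    fun a b' k ↦ (support_add (SK₁ a b' k) (SK₂ a b' k)).trans (union_subset_union (hK₁s a b' k) (hK₂s a b' k)),
    fun ψ hψ hψc ↦ ?_⟩
  obtain ⟨IV₁, IK₁, E₁⟩ := hP₁ ψ hψ hψc
  obtain ⟨IV₂, IK₂, E₂⟩ := hP₂ ψ hψ hψc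
  refine ⟨fun a k j i ↦ ((IV₁ a k j i).add (IV₂ a k j i)).congr (ae_of_all _ fun x ↦ by
      simp only [Pi.add_apply]; ring),
    fun a b' k j i m ↦ ((IK₁ a b' k j i m).add (IK₂ a b' k j i m)).congr (ae_of_all _ fun x ↦ by
      simp only [Pi.add_apply]; ring), ?_⟩
  rw [symmDivPairing_add IV₁ IV₂ IK₁ IK₂, E₁, E₂, ← neg_add, ← Finset.sum_add_distrib]
  congr 1
  refine Finset.sum_congr rfl fun j _ ↦ ?_
  have I : ∀ (χ : E3 → ℝ), Continuous χ → Integrable fun y : E3 ↦ momentPartK η F χ j y * ψ j y := fun χ hχ ↦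
    ((continuous_momentPartK hη hF hχ j).mul (hψ j).continuous).integrable_of_hasCompactSupport
      (hasCompactSupport_momentPartK hηc hFc χ j).mul_right
  rw [← integral_add (I χ₁ hχ₁) (I χ₂ hχ₂)]
  refine integral_congr_ae (ae_of_all _ fun y ↦ ?_)
  simp only
  rw [← add_mul, momentPartK_add_momentPartK_of_moments hF hFc hχ₁ hχ₂ hsum hK j y]

/-- **The recursion**: a finite chain of open sets, each with weak solvability and each meeting the union of the
previous ones, has a union with weak solvability. [cite: MaoOhTao2023, Lemma 2.2 (proof)] -/
theorem HasWeakSymmDivInverse.biUnion_le {V : ℕ → Set E3} (hVo : ∀ k, IsOpen (V k))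
    (hV : ∀ k, HasWeakSymmDivInverse (V k))
    (hchain : ∀ k, ∃ p, p ∈ V (k + 1) ∧ p ∈ ⋃ i ≤ k, V i) (n : ℕ) :
    HasWeakSymmDivInverse (⋃ i ≤ n, V i) := by
  induction n with
  | zero =>
    have h0 : (⋃ i ≤ 0, V i) = V 0 := by
      ext x
      simp only [mem_iUnion, exists_prop, Nat.le_zero]
      exact ⟨fun ⟨i, hi, hx⟩ ↦ hi ▸ hx, fun hx ↦ ⟨0, rfl, hx⟩⟩
    rw [h0]
    exact hV 0
  | succ n ih =>
    rw [Set.biUnion_le_succ]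
    obtain ⟨p, hp1, hp2⟩ := hchain n
    exact ih.union (isOpen_biUnion fun i _ ↦ hVo i) (hVo (n + 1)) hp2 hp1 (hV (n + 1))

end Recursion

/-! ### The annulus -/

section Annulus

/-- Each sector of the gluing sequence has weak solvability of the symmetric divergence equation.
[cite: MaoOhTao2023, Lemma 2.2 (proof)] -/
theorem hasWeakSymmDivInverse_annSector_dirSeq (n : ℕ) : HasWeakSymmDivInverse (annSector (dirSeq n)) :=
  HasWeakSymmDivInverse.of_starConvex (c := ((3 / 2 : ℝ) * ‖dirSeq n‖⁻¹) • dirSeq n) (r := 1 / 20)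
    (by norm_num) fun _ hb ↦ starConvex_annSector (dirSeq_ne_zero n) hb

/-- **Lemma 2.2, (T1)–(T2) in weak form**: the annulus `A₁ = {1 < |x| < 2}` has weak solvability of the symmetric
divergence equation (recursion over the fourteen sectors of `AnnulusStarCover.lean`). [cite: MaoOhTao2023, Lemma 2.2] -/
theorem hasWeakSymmDivInverse_annulus : HasWeakSymmDivInverse {x : E3 | 1 < ‖x‖ ∧ ‖x‖ < 2} := by
  rw [← biUnion_annSector_dirSeq_eq]
  exact HasWeakSymmDivInverse.biUnion_le (fun k ↦ isOpen_annSector _) hasWeakSymmDivInverse_annSector_dirSeq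
    dirSeq_chain 13

/-- **Lemma 2.2 (T1)–(T2), unfolded**: every `F ∈ C_c(ℝ³; ℝ³)` with `tsupp F^k ⊆ A₁` and vanishing Killing moments
`∫ F·e_l = ∫ F·Y_l = 0` admits divergence-form fields `SV, SK` supported in `A₁` with
`Σ_{i,j}⟨(T F)^{ij}, ∂ᵢψⱼ⟩ = −Σ_j ∫ F^j ψ_j` for all `ψ ∈ C²_c(ℝ³; ℝ³)`, i.e. `∂_i (T F)^{ij} = F^j` in `𝒟'(ℝ³)` for the
symmetric distribution `(T F)^{ij} = ½(SV^i_j + SV^j_i) + ½∂_m(SK^{im}_j + SK^{jm}_i) − ∂_k SK^{ij}_k` supported in `A₁`.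
[cite: MaoOhTao2023, Lemma 2.2] -/
theorem exists_weak_symmDiv_inverse_annulus (F : Fin 3 → E3 → ℝ) (hF : ∀ k, Continuous (F k))
    (hFc : ∀ k, HasCompactSupport (F k)) (hFA : ∀ k, tsupport (F k) ⊆ {x : E3 | 1 < ‖x‖ ∧ ‖x‖ < 2})
    (hK : ∀ a, ∫ y : E3, ∑ j, F j y * killingFn a y j = 0) :
    ∃ (SV : Fin 3 → Fin 3 → E3 → ℝ) (SK : Fin 3 → Fin 3 → Fin 3 → E3 → ℝ),
      (∀ a k, support (SV a k) ⊆ {x : E3 | 1 < ‖x‖ ∧ ‖x‖ < 2}) ∧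
        (∀ a b k, support (SK a b k) ⊆ {x : E3 | 1 < ‖x‖ ∧ ‖x‖ < 2}) ∧
          ∀ ψ : Fin 3 → E3 → ℝ, (∀ j, ContDiff ℝ 2 (ψ j)) → (∀ j, HasCompactSupport (ψ j)) →
            (∀ a k j i, Integrable fun x : E3 ↦ SV a k x * pd i (ψ j) x) ∧
              (∀ a b k j i m, Integrable fun x : E3 ↦ SK a b k x * pd m (pd i (ψ j)) x) ∧
                symmDivPairing SV SK ψ = -∑ j, ∫ y : E3, F j y * ψ j y :=
  hasWeakSymmDivInverse_annulus F hF hFc hFA hK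

end Annulus


end MaoOhTao

end Literature.Geometry.Lorentzian

end
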